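import Summits.ValiantsHypothesis.ValiantsHypothesis.Theorems.KPlusLogSqLawTropicalBToeplitzMorphFeasibleSame
import Summits.ValiantsHypothesis.ValiantsHypothesis.Theorems.KPlusLogSqLawTropicalBToeplitzMorphFeasibleOpp

/-!
# Route `KPlusLogSqLaw`, crux `TropicalB` — Toeplitz sector: MORPH THEOREM — position-level feasibility and the RANK decrease on rungs

HONEST FRAMING.  Helper toward the registered stubs `stub_tropThin` / `stub_tropFat` (crux `…Theses.KPlusLogSqLaw.TropicalB`, item
`stmt-ValiantsHypothesis-19771`; cell `pub-symmetroid`, seat `val-sym-trop-p4` (g23), 2026-08-29).  Positions `a, b ∈ [0, 4q)` (value `a`,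
position `b`), coordinate `X` (distance from the centre pair), the abstract dual potential `f` (five zone formulas) and the abstract morph
involution `g` (ten zone formulas), as in `…ToeplitzMorphTight`.  `morph_pair`: for `a ≠ b`,
`f(X a) + f(X b) + |a−b|(K − 2|a−b|) ≤ c` (from `…MorphFeasibleSame/Opp` according to the sides of `a`, `b`), and if EQUALITY holds then
either `a = g b` (the pair is matched) or the RANK drops: `(4·X(g a) − ν)² < (4·X b − ν)²`, `ν = 4q+4h+1` — checked on each of the tight
loci (A–B ladder rungs, B–E pairs, zipper rungs) by one sign computation.  With `…ToeplitzMorphDuality` this yields uniqueness of the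
optimum (`…ToeplitzMorphMember`).  Definition-free; generated (HOME/val-sym-trop-p4/g23/tools/cert/leanrank.py).  Nothing here bounds
`Φ_Toep`; `ConjectureTPoly` / `TropicalB` stay OPEN; nothing on `MatrixDescartes` or `VP ≠ VNP`.
-/

set_option linter.dupNamespace false
set_option autoImplicit false

namespace Summit.ValiantsHypothesis.ValiantsHypothesis.Theorems.KPlusLogSqLaw.Toeplitz


set_option maxHeartbeats 1600000 in
/-- **Position-level feasibility and rank decrease.**  For `a ≠ b` in `[0, 4q)`: `f(X a) + f(X b) + |a−b|(K−2|a−b|) ≤ c`, and equality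
forces `a = g b` or `(4 X(g a) − ν)² < (4 X b − ν)²`. [folklore] -/
theorem morph_pair (q h : ℤ) (hq : 2 * h + 2 ≤ q) (hh : 0 ≤ h) (f X g : ℤ → ℤ)
    (hf1e : ∀ t : ℤ, 0 ≤ t → t ≤ h → f (2 * t) = (4)*t^2)
    (hf1o : ∀ t : ℤ, 0 ≤ t → t + 1 ≤ h → f (2 * t + 1) = (4)*t^2 + (4)*t + (1))
    (hf2 : ∀ x : ℤ, 2 * h + 1 ≤ x → x ≤ q - 1 → f x = (4)*h*x + (-4)*h^2 + (-2)*h + (1)*x)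
    (hf3 : ∀ x : ℤ, q ≤ x → x ≤ q + h → f x = (4)*h*x + (-4)*h^2 + (4)*q*x + (-2)*q^2 + (-2)*x^2 + (-2)*h + (2)*q + (-1)*x)
    (hf4 : ∀ x : ℤ, q + h + 1 ≤ x → x ≤ q + 2 * h + 1 → f x = (4)*h*x + (-4)*h^2 + (4)*q*x + (-2)*q^2 + (-2)*x^2 + (-6)*h + (-2)*q + (3)*x + (-1))
    (hf5 : ∀ x : ℤ, q + 2 * h + 2 ≤ x → x ≤ 2 * q - 1 → f x = (8)*h*q + (-4)*h*x + (4)*h^2 + (2)*h + (2)*q + (-1)*x + (1))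
    (hxL : ∀ p : ℤ, 0 ≤ p → p ≤ 2 * q - 1 → X p = 2 * q - 1 - p)
    (hxR : ∀ p : ℤ, 2 * q ≤ p → p ≤ 4 * q - 1 → X p = p - 2 * q)
    (hgA1 : ∀ p : ℤ, 0 ≤ p → p ≤ q - 2 * h - 2 → g p = p + q)
    (hgA2 : ∀ p : ℤ, q - 2 * h - 2 ≤ p → p ≤ q - 1 → g p = 2 * p + 2 * h + 2)
    (hgB : ∀ p : ℤ, q ≤ p → p ≤ 2 * q - 2 * h - 2 → g p = p - q)
    (hgCe : ∀ s : ℤ, 0 ≤ s → s ≤ h → g (2 * q - 1 - 2 * s) = 3 * q + h - s)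
    (hgCo : ∀ s : ℤ, 0 ≤ s → s + 1 ≤ h → g (2 * q - 2 - 2 * s) = q - h - 2 - s)
    (hgDo : ∀ s : ℤ, 0 ≤ s → s + 1 ≤ h → g (2 * q + 2 * s + 1) = 3 * q + h + 1 + s)
    (hgDe : ∀ s : ℤ, 0 ≤ s → s ≤ h → g (2 * q + 2 * s) = q - h - 1 + s)
    (hgE : ∀ p : ℤ, 2 * q + 2 * h + 1 ≤ p → p ≤ 3 * q - 1 → g p = p + q)
    (hgF1 : ∀ p : ℤ, 3 * q ≤ p → p ≤ 3 * q + 2 * h + 1 → g p = 2 * p - 4 * q - 2 * h - 1)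
    (hgF2 : ∀ p : ℤ, 3 * q + 2 * h + 1 ≤ p → p ≤ 4 * q - 1 → g p = p - q)
    (a b : ℤ) (ha0 : 0 ≤ a) (ha1 : a ≤ 4 * q - 1) (hb0 : 0 ≤ b) (hb1 : b ≤ 4 * q - 1) (hab : a ≠ b) :
    f (X a) + f (X b) + |a - b| * ((4 * q + 4 * h + 3) - 2 * |a - b|) ≤ (8)*h*q + (2)*q^2 + (4)*q + (1) ∧
      (f (X a) + f (X b) + |a - b| * ((4 * q + 4 * h + 3) - 2 * |a - b|) = (8)*h*q + (2)*q^2 + (4)*q + (1) →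
        a = g b ∨ (4 * X (g a) - (4 * q + 4 * h + 1)) ^ 2 < (4 * X b - (4 * q + 4 * h + 1)) ^ 2) := by
  rcases lt_or_ge a (2 * q) with sa | sa <;> rcases lt_or_ge b (2 * q) with sb | sb
  · have hXa := hxL a (by omega) (by omega)
    have hXb := hxL b (by omega) (by omega)
    rcases lt_or_gt_of_ne hab with hlt | hlt
    · have hd : |a - b| = b - a := by rw [abs_of_nonpos (by omega : a - b ≤ 0)]; ring
      obtain ⟨hle, hchar⟩ := morph_feasible_same q h hq hh f hf1e hf1o hf2 hf3 hf4 hf5 (X b) (X a) (b - a) (by omega) (by omega) (by omega) (by omega)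
      refine ⟨by rw [hd]; linarith [hle], fun heq => ?_⟩
      have hT := hchar (by rw [hd] at heq; linarith [heq])
      rcases hT with ⟨h1, h2, h3 | h3⟩ | ⟨t, ht1, ht2, ht3, ht4⟩ | ⟨t, ht1, ht2, ht3, ht4⟩
      · left
        have e := hgB b (by omega) (by omega); omega
      · have hga : g a = a + q := hgA1 a (by omega) (by omega)
        have hXga : X (g a) = 2 * q - 1 - (a + q) := by rw [hga]; exact hxL (a + q) (by omega) (by omega)
        right
        nlinarith [mul_pos_of_neg_of_neg (show (4 * X b - (4 * q + 4 * h + 1)) - (4 * X (g a) - (4 * q + 4 * h + 1)) < 0 by omega) (show (4 * X b - (4 * q + 4 * h + 1)) + (4 * X (g a) - (4 * q + 4 * h + 1)) < 0 by omega)]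
      · have hga : g a = 2 * a + 2 * h + 2 := hgA2 a (by omega) (by omega)
        have hXga : X (g a) = 2 * q - 1 - (2 * a + 2 * h + 2) := by rw [hga]; exact hxL (2 * a + 2 * h + 2) (by omega) (by omega)
        right
        nlinarith [mul_pos_of_neg_of_neg (show (4 * X b - (4 * q + 4 * h + 1)) - (4 * X (g a) - (4 * q + 4 * h + 1)) < 0 by omega) (show (4 * X b - (4 * q + 4 * h + 1)) + (4 * X (g a) - (4 * q + 4 * h + 1)) < 0 by omega)]
      · left
        have hb' : b = 2 * q - 2 - 2 * t := by omega
        rw [hb', hgCo t (by omega) (by omega)]; omega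
    · have hd : |a - b| = a - b := abs_of_nonneg (by omega)
      obtain ⟨hle, hchar⟩ := morph_feasible_same q h hq hh f hf1e hf1o hf2 hf3 hf4 hf5 (X a) (X b) (a - b) (by omega) (by omega) (by omega) (by omega)
      refine ⟨by rw [hd]; linarith [hle], fun heq => ?_⟩
      have hT := hchar (by rw [hd] at heq; linarith [heq])
      rcases hT with ⟨h1, h2, h3 | h3⟩ | ⟨t, ht1, ht2, ht3, ht4⟩ | ⟨t, ht1, ht2, ht3, ht4⟩
      · left
        have e := hgA1 b (by omega) (by omega); omega
      · have hga : g a = a - q := hgB a (by omega) (by omega)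
        have hXga : X (g a) = 2 * q - 1 - (a - q) := by rw [hga]; exact hxL (a - q) (by omega) (by omega)
        right
        nlinarith [mul_pos (show (0:ℤ) < (4 * X b - (4 * q + 4 * h + 1)) - (4 * X (g a) - (4 * q + 4 * h + 1)) by omega) (show (0:ℤ) < (4 * X b - (4 * q + 4 * h + 1)) + (4 * X (g a) - (4 * q + 4 * h + 1)) by omega)]
      · have ha' : a = 2 * q - 1 - 2 * t := by omega
        have hga : g a = 3 * q + h - t := by rw [ha']; exact hgCe t (by omega) (by omega)
        have hXga : X (g a) = (3 * q + h - t) - 2 * q := by rw [hga]; exact hxR (3 * q + h - t) (by omega) (by omega)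
        right
        nlinarith [mul_pos (show (0:ℤ) < (4 * X b - (4 * q + 4 * h + 1)) - (4 * X (g a) - (4 * q + 4 * h + 1)) by omega) (show (0:ℤ) < (4 * X b - (4 * q + 4 * h + 1)) + (4 * X (g a) - (4 * q + 4 * h + 1)) by omega)]
      · left
        have e := hgA2 b (by omega) (by omega); omega
  · have hXa := hxL a (by omega) (by omega)
    have hXb := hxR b (by omega) (by omega)
    have hd : |a - b| = b - a := by rw [abs_of_nonpos (by omega : a - b ≤ 0)]; ring
    rcases le_or_gt (X a) (X b) with hxy | hxy
    · obtain ⟨hle, hchar⟩ := morph_feasible_opp q h hq hh f hf1e hf1o hf2 hf3 hf4 hf5 (X a) (X b) (b - a) (by omega) (by omega) (by omega) (by omega)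
      refine ⟨by rw [hd]; linarith [hle], fun heq => ?_⟩
      have hT := hchar (by rw [hd] at heq; linarith [heq])
      rcases hT with ⟨h1, h2, h3, h4, h5⟩ | ⟨t, ht1, ht2, ht3, ht4⟩ | ⟨t, ht1, ht2, ht3, ht4⟩
      · have hga : g a = a - q := hgB a (by omega) (by omega)
        have hXga : X (g a) = 2 * q - 1 - (a - q) := by rw [hga]; exact hxL (a - q) (by omega) (by omega)
        right
        nlinarith [mul_pos_of_neg_of_neg (show (4 * X b - (4 * q + 4 * h + 1)) - (4 * X (g a) - (4 * q + 4 * h + 1)) < 0 by omega) (show (4 * X b - (4 * q + 4 * h + 1)) + (4 * X (g a) - (4 * q + 4 * h + 1)) < 0 by omega)]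
      · left
        have e := hgF1 b (by omega) (by omega); omega
      · have ha' : a = 2 * q - 2 - 2 * t := by omega
        have hga : g a = q - h - 2 - t := by rw [ha']; exact hgCo t (by omega) (by omega)
        have hXga : X (g a) = 2 * q - 1 - (q - h - 2 - t) := by rw [hga]; exact hxL (q - h - 2 - t) (by omega) (by omega)
        right
        nlinarith [mul_pos_of_neg_of_neg (show (4 * X b - (4 * q + 4 * h + 1)) - (4 * X (g a) - (4 * q + 4 * h + 1)) < 0 by omega) (show (4 * X b - (4 * q + 4 * h + 1)) + (4 * X (g a) - (4 * q + 4 * h + 1)) < 0 by omega)]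
    · obtain ⟨hle, hchar⟩ := morph_feasible_opp q h hq hh f hf1e hf1o hf2 hf3 hf4 hf5 (X b) (X a) (b - a) (by omega) (by omega) (by omega) (by omega)
      refine ⟨by rw [hd]; linarith [hle], fun heq => ?_⟩
      have hT := hchar (by rw [hd] at heq; linarith [heq])
      rcases hT with ⟨h1, h2, h3, h4, h5⟩ | ⟨t, ht1, ht2, ht3, ht4⟩ | ⟨t, ht1, ht2, ht3, ht4⟩
      · have hga : g a = a - q := hgB a (by omega) (by omega)
        have hXga : X (g a) = 2 * q - 1 - (a - q) := by rw [hga]; exact hxL (a - q) (by omega) (by omega)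
        right
        nlinarith [mul_pos_of_neg_of_neg (show (4 * X b - (4 * q + 4 * h + 1)) - (4 * X (g a) - (4 * q + 4 * h + 1)) < 0 by omega) (show (4 * X b - (4 * q + 4 * h + 1)) + (4 * X (g a) - (4 * q + 4 * h + 1)) < 0 by omega)]
      · left
        have hb' : b = 2 * q + 2 * t := by omega
        rw [hb', hgDe t (by omega) (by omega)]; omega
      · have hga : g a = 2 * a + 2 * h + 2 := hgA2 a (by omega) (by omega)
        have hXga : X (g a) = (2 * a + 2 * h + 2) - 2 * q := by rw [hga]; exact hxR (2 * a + 2 * h + 2) (by omega) (by omega)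
        right
        nlinarith [mul_pos_of_neg_of_neg (show (4 * X b - (4 * q + 4 * h + 1)) - (4 * X (g a) - (4 * q + 4 * h + 1)) < 0 by omega) (show (4 * X b - (4 * q + 4 * h + 1)) + (4 * X (g a) - (4 * q + 4 * h + 1)) < 0 by omega)]
  · have hXa := hxR a (by omega) (by omega)
    have hXb := hxL b (by omega) (by omega)
    have hd : |a - b| = a - b := abs_of_nonneg (by omega)
    rcases le_or_gt (X a) (X b) with hxy | hxy
    · obtain ⟨hle, hchar⟩ := morph_feasible_opp q h hq hh f hf1e hf1o hf2 hf3 hf4 hf5 (X a) (X b) (a - b) (by omega) (by omega) (by omega) (by omega)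
      refine ⟨by rw [hd]; linarith [hle], fun heq => ?_⟩
      have hT := hchar (by rw [hd] at heq; linarith [heq])
      rcases hT with ⟨h1, h2, h3, h4, h5⟩ | ⟨t, ht1, ht2, ht3, ht4⟩ | ⟨t, ht1, ht2, ht3, ht4⟩
      · have hga : g a = a + q := hgE a (by omega) (by omega)
        have hXga : X (g a) = (a + q) - 2 * q := by rw [hga]; exact hxR (a + q) (by omega) (by omega)
        right
        nlinarith [mul_pos_of_neg_of_neg (show (4 * X b - (4 * q + 4 * h + 1)) - (4 * X (g a) - (4 * q + 4 * h + 1)) < 0 by omega) (show (4 * X b - (4 * q + 4 * h + 1)) + (4 * X (g a) - (4 * q + 4 * h + 1)) < 0 by omega)]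
      · left
        have e := hgA2 b (by omega) (by omega); omega
      · have ha' : a = 2 * q + 2 * t + 1 := by omega
        have hga : g a = 3 * q + h + 1 + t := by rw [ha']; exact hgDo t (by omega) (by omega)
        have hXga : X (g a) = (3 * q + h + 1 + t) - 2 * q := by rw [hga]; exact hxR (3 * q + h + 1 + t) (by omega) (by omega)
        right
        nlinarith [mul_pos_of_neg_of_neg (show (4 * X b - (4 * q + 4 * h + 1)) - (4 * X (g a) - (4 * q + 4 * h + 1)) < 0 by omega) (show (4 * X b - (4 * q + 4 * h + 1)) + (4 * X (g a) - (4 * q + 4 * h + 1)) < 0 by omega)]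
    · obtain ⟨hle, hchar⟩ := morph_feasible_opp q h hq hh f hf1e hf1o hf2 hf3 hf4 hf5 (X b) (X a) (a - b) (by omega) (by omega) (by omega) (by omega)
      refine ⟨by rw [hd]; linarith [hle], fun heq => ?_⟩
      have hT := hchar (by rw [hd] at heq; linarith [heq])
      rcases hT with ⟨h1, h2, h3, h4, h5⟩ | ⟨t, ht1, ht2, ht3, ht4⟩ | ⟨t, ht1, ht2, ht3, ht4⟩
      · have hga : g a = a + q := hgE a (by omega) (by omega)
        have hXga : X (g a) = (a + q) - 2 * q := by rw [hga]; exact hxR (a + q) (by omega) (by omega)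
        right
        nlinarith [mul_pos_of_neg_of_neg (show (4 * X b - (4 * q + 4 * h + 1)) - (4 * X (g a) - (4 * q + 4 * h + 1)) < 0 by omega) (show (4 * X b - (4 * q + 4 * h + 1)) + (4 * X (g a) - (4 * q + 4 * h + 1)) < 0 by omega)]
      · left
        have hb' : b = 2 * q - 1 - 2 * t := by omega
        rw [hb', hgCe t (by omega) (by omega)]; omega
      · have hga : g a = 2 * a - 4 * q - 2 * h - 1 := hgF1 a (by omega) (by omega)
        have hXga : X (g a) = 2 * q - 1 - (2 * a - 4 * q - 2 * h - 1) := by rw [hga]; exact hxL (2 * a - 4 * q - 2 * h - 1) (by omega) (by omega)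
        right
        nlinarith [mul_pos_of_neg_of_neg (show (4 * X b - (4 * q + 4 * h + 1)) - (4 * X (g a) - (4 * q + 4 * h + 1)) < 0 by omega) (show (4 * X b - (4 * q + 4 * h + 1)) + (4 * X (g a) - (4 * q + 4 * h + 1)) < 0 by omega)]
  · have hXa := hxR a (by omega) (by omega)
    have hXb := hxR b (by omega) (by omega)
    rcases lt_or_gt_of_ne hab with hlt | hlt
    · have hd : |a - b| = b - a := by rw [abs_of_nonpos (by omega : a - b ≤ 0)]; ring
      obtain ⟨hle, hchar⟩ := morph_feasible_same q h hq hh f hf1e hf1o hf2 hf3 hf4 hf5 (X a) (X b) (b - a) (by omega) (by omega) (by omega) (by omega)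
      refine ⟨by rw [hd]; linarith [hle], fun heq => ?_⟩
      have hT := hchar (by rw [hd] at heq; linarith [heq])
      rcases hT with ⟨h1, h2, h3 | h3⟩ | ⟨t, ht1, ht2, ht3, ht4⟩ | ⟨t, ht1, ht2, ht3, ht4⟩
      · left
        have e := hgF2 b (by omega) (by omega); omega
      · have hga : g a = a + q := hgE a (by omega) (by omega)
        have hXga : X (g a) = (a + q) - 2 * q := by rw [hga]; exact hxR (a + q) (by omega) (by omega)
        right
        nlinarith [mul_pos (show (0:ℤ) < (4 * X b - (4 * q + 4 * h + 1)) - (4 * X (g a) - (4 * q + 4 * h + 1)) by omega) (show (0:ℤ) < (4 * X b - (4 * q + 4 * h + 1)) + (4 * X (g a) - (4 * q + 4 * h + 1)) by omega)]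
      · have ha' : a = 2 * q + 2 * t := by omega
        have hga : g a = q - h - 1 + t := by rw [ha']; exact hgDe t (by omega) (by omega)
        have hXga : X (g a) = 2 * q - 1 - (q - h - 1 + t) := by rw [hga]; exact hxL (q - h - 1 + t) (by omega) (by omega)
        right
        nlinarith [mul_pos (show (0:ℤ) < (4 * X b - (4 * q + 4 * h + 1)) - (4 * X (g a) - (4 * q + 4 * h + 1)) by omega) (show (0:ℤ) < (4 * X b - (4 * q + 4 * h + 1)) + (4 * X (g a) - (4 * q + 4 * h + 1)) by omega)]
      · left
        have e := hgF1 b (by omega) (by omega); omega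
    · have hd : |a - b| = a - b := abs_of_nonneg (by omega)
      obtain ⟨hle, hchar⟩ := morph_feasible_same q h hq hh f hf1e hf1o hf2 hf3 hf4 hf5 (X b) (X a) (a - b) (by omega) (by omega) (by omega) (by omega)
      refine ⟨by rw [hd]; linarith [hle], fun heq => ?_⟩
      have hT := hchar (by rw [hd] at heq; linarith [heq])
      rcases hT with ⟨h1, h2, h3 | h3⟩ | ⟨t, ht1, ht2, ht3, ht4⟩ | ⟨t, ht1, ht2, ht3, ht4⟩
      · left
        have e := hgE b (by omega) (by omega); omega
      · have hga : g a = a - q := hgF2 a (by omega) (by omega)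
        have hXga : X (g a) = (a - q) - 2 * q := by rw [hga]; exact hxR (a - q) (by omega) (by omega)
        right
        nlinarith [mul_pos_of_neg_of_neg (show (4 * X b - (4 * q + 4 * h + 1)) - (4 * X (g a) - (4 * q + 4 * h + 1)) < 0 by omega) (show (4 * X b - (4 * q + 4 * h + 1)) + (4 * X (g a) - (4 * q + 4 * h + 1)) < 0 by omega)]
      · have hga : g a = 2 * a - 4 * q - 2 * h - 1 := hgF1 a (by omega) (by omega)
        have hXga : X (g a) = (2 * a - 4 * q - 2 * h - 1) - 2 * q := by rw [hga]; exact hxR (2 * a - 4 * q - 2 * h - 1) (by omega) (by omega)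
        right
        nlinarith [mul_pos_of_neg_of_neg (show (4 * X b - (4 * q + 4 * h + 1)) - (4 * X (g a) - (4 * q + 4 * h + 1)) < 0 by omega) (show (4 * X b - (4 * q + 4 * h + 1)) + (4 * X (g a) - (4 * q + 4 * h + 1)) < 0 by omega)]
      · left
        have hb' : b = 2 * q + 2 * t + 1 := by omega
        rw [hb', hgDo t (by omega) (by omega)]; omega

end Summit.ValiantsHypothesis.ValiantsHypothesis.Theorems.KPlusLogSqLaw.Toeplitz
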